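import Literature.Analysis.FluidPDE.PeriodicLerayCompactness
import Literature.Analysis.UnboundedOperators.HeatKernel
import HarnessLib

/-!
# [BT1] proof of Theorem 2.4, the limit `ε → 0`, V: the mollified drift converges to the limit
  velocity in `L³` of every cylinder

Analysis/FluidPDE proof file (theorems only, no new definitions, no named facts), fifth part of
the discharge of the named fact `Literature.Analysis.FluidPDE.bradshawTsai2017_thm_2_4_limit`
(`PeriodicLerayExistence.lean`; Bradshaw–Tsai, Ann. Henri Poincaré 18 (2017) =
arXiv:1510.07504 [BT1], §2, proof of Thm 2.4): "this convergence is strong enough to ensure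
that `(u, p)` solves (2.1) in the distributional sense" — the only term of the mollified
perturbed Leray system which is not covered by the strong convergence of the `U_{ε_k}` and the
weak convergence of the pressures is the mollified drift `η_{ε_k} * U_{ε_k}`, which converges to
`U` in `L³` (hence `L²`) of every bounded cylinder because `ε_k → 0`:
`‖η_ε * U_k − U‖_{L³(Q)} ≤ ‖η‖_{L¹} ‖U_k − U‖_{L³(Q⁺)} + ‖η_ε * U − U‖_{L³(Q)}`, `Q⁺` the cylinder with
the radius enlarged by one (locality of the convolution with a kernel supported in `B(0, ερ)`,
Young's inequality slice by slice), and `η_ε * U → U` in `L³(Q)` for the fixed field `U` (density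
of continuous compactly supported fields in `L³`, uniform continuity, Young again). The kernel
`η ∈ C_c^∞`, `∫η = 1`, may be signed.

* `mollify_apply_congr_of_ball`, `setLIntegral_mollify_rpow_le` — locality and the local
  Young inequality for one slice;
* `setLIntegral_cylinder_mollify_rpow_le` — the local Young inequality on cylinders (Tonelli);
* `tendsto_eLpNorm_mollify_sub_self` — `η_ε * V → V` in `L³(Q)` for a fixed `V ∈ L³(Q⁺)`;
* `tendsto_eLpNorm_mollify_sub_limit` — **`η_{ε_k} * U_k → U` in `L³(Q)`** when `U_k → U` in
  `L³(Q⁺)` and `ε_k → 0`.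

## References

* Z. Bradshaw, T.-P. Tsai, Ann. Henri Poincaré 18 (2017) 1095–1119 = arXiv:1510.07504, §2,
  proof of Thm 2.4 [BradshawTsai2017AHP].
* L. C. Evans, *Partial Differential Equations* (2010), App. C.4, Thm. 7 (mollifiers)
  [Evans2010].
-/

noncomputable section

open MeasureTheory TopologicalSpace Set Function Filter Metric Bornology
open scoped NNReal ENNReal Topology Convolution

namespace Literature.Analysis.FluidPDE

namespace BradshawTsai2017

/-! ### Locality of the mollification and the local Young inequality for one slice -/

section Slice

variable {η : EuclideanSpace ℝ (Fin 3) → ℝ}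

/-- A mollifying kernel vanishes outside some ball `B(0, ρ)`, `ρ > 0`. [folklore] -/
theorem IsMollifyingKernel.exists_support_radius (hη : IsMollifyingKernel η) :
    ∃ ρ : ℝ, 0 < ρ ∧ ∀ y : EuclideanSpace ℝ (Fin 3), ρ ≤ ‖y‖ → η y = 0 := by
  obtain ⟨r, hr⟩ := hη.hasCompactSupport.isCompact.isBounded.subset_closedBall (0 : EuclideanSpace ℝ (Fin 3))
  refine ⟨|r| + 1, by positivity, fun y hy => image_eq_zero_of_notMem_tsupport fun h' => ?_⟩
  have := mem_closedBall_zero_iff.1 (hr h')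
  linarith [le_abs_self r]

/-- The scaled kernel `η_ε` is nonzero only on `B(0, ερ)`. [folklore] -/
theorem norm_lt_of_scaledMollifier_ne_zero {ρ : ℝ} (hρ : ∀ y : EuclideanSpace ℝ (Fin 3), ρ ≤ ‖y‖ → η y = 0)
    {ε : ℝ} (hε : 0 < ε) {t : EuclideanSpace ℝ (Fin 3)} (ht : BradshawTsai2019.scaledMollifier η ε t ≠ 0) :
    ‖t‖ < ε * ρ := by
  by_contra h
  exact ht (BradshawTsai2019.scaledMollifier_eq_zero hρ hε (not_lt.1 h))

/-- **Locality of the mollification**: if `η` vanishes outside `B(0, ρ)` and two fields agree on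
`B(y, ερ)`, their mollifications at scale `ε` agree at `y`. [folklore] -/
theorem mollify_apply_congr_of_ball {ρ : ℝ} (hρ : ∀ y : EuclideanSpace ℝ (Fin 3), ρ ≤ ‖y‖ → η y = 0)
    {ε : ℝ} (hε : 0 < ε) {U V : ℝ → EuclideanSpace ℝ (Fin 3) → EuclideanSpace ℝ (Fin 3)} {s : ℝ}
    {y : EuclideanSpace ℝ (Fin 3)} (h : ∀ w ∈ ball y (ε * ρ), U s w = V s w) :
    mollify η ε U s y = mollify η ε V s y := by
  rw [mollify_apply, mollify_apply]
  refine integral_congr_ae (Eventually.of_forall fun t => ?_)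
  show BradshawTsai2019.scaledMollifier η ε t • U s (y - t) = BradshawTsai2019.scaledMollifier η ε t • V s (y - t)
  by_cases ht : BradshawTsai2019.scaledMollifier η ε t = 0
  · simp only [ht, zero_smul]
  · rw [h (y - t) ?_]
    rw [mem_ball, dist_eq_norm, sub_sub_cancel_left, norm_neg]
    exact norm_lt_of_scaledMollifier_ne_zero hρ hε ht

/-- On `B(0, R)` the mollification at scale `ε` with `ερ ≤ 1` only sees the field on
`B(0, R + 1)`: it agrees with the mollification of the field cut off outside `B(0, R + 1)`.
[folklore] -/
theorem mollify_apply_eq_mollify_indicator {ρ : ℝ} (hρ : ∀ y : EuclideanSpace ℝ (Fin 3), ρ ≤ ‖y‖ → η y = 0)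
    {ε : ℝ} (hε : 0 < ε) (hερ : ε * ρ ≤ 1) (U : ℝ → EuclideanSpace ℝ (Fin 3) → EuclideanSpace ℝ (Fin 3))
    {R : ℝ} {s : ℝ} {y : EuclideanSpace ℝ (Fin 3)} (hy : y ∈ ball (0 : EuclideanSpace ℝ (Fin 3)) R) :
    mollify η ε U s y =
      mollify η ε (fun s => (ball (0 : EuclideanSpace ℝ (Fin 3)) (R + 1)).indicator (U s)) s y := by
  refine mollify_apply_congr_of_ball hρ hε fun w hw => ?_
  have hw' : w ∈ ball (0 : EuclideanSpace ℝ (Fin 3)) (R + 1) := by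
    rw [mem_ball_zero_iff] at hy ⊢
    rw [mem_ball, dist_eq_norm] at hw
    calc ‖w‖ = ‖(w - y) + y‖ := by rw [sub_add_cancel]
      _ ≤ ‖w - y‖ + ‖y‖ := norm_add_le _ _
      _ < 1 + R := by linarith
      _ = R + 1 := add_comm _ _
  rw [indicator_of_mem hw']

/-- **The local Young inequality for one slice**: for `ερ ≤ 1` and `1 ≤ q`,
`∫_{B(0,R)} |η_ε * f|^q ≤ ‖η‖₁^q ∫_{B(0,R+1)} |f|^q`. [folklore] -/
theorem setLIntegral_mollify_rpow_le (hη : IsMollifyingKernel η) {ρ : ℝ}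
    (hρ : ∀ y : EuclideanSpace ℝ (Fin 3), ρ ≤ ‖y‖ → η y = 0) {ε : ℝ} (hε : 0 < ε) (hερ : ε * ρ ≤ 1)
    {U : ℝ → EuclideanSpace ℝ (Fin 3) → EuclideanSpace ℝ (Fin 3)} {s : ℝ}
    (hUs : AEStronglyMeasurable (U s) (volume : Measure (EuclideanSpace ℝ (Fin 3)))) {q : ℝ} (hq : 1 ≤ q) (R : ℝ) :
    ∫⁻ y in ball (0 : EuclideanSpace ℝ (Fin 3)) R, ‖mollify η ε U s y‖ₑ ^ q ≤
      (∫⁻ y, ‖η y‖ₑ) ^ q * ∫⁻ y in ball (0 : EuclideanSpace ℝ (Fin 3)) (R + 1), ‖U s y‖ₑ ^ q := by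
  set V : ℝ → EuclideanSpace ℝ (Fin 3) → EuclideanSpace ℝ (Fin 3) := fun s =>
    (ball (0 : EuclideanSpace ℝ (Fin 3)) (R + 1)).indicator (U s) with hV
  have hVs : AEStronglyMeasurable (V s) (volume : Measure (EuclideanSpace ℝ (Fin 3))) :=
    hUs.indicator measurableSet_ball
  calc ∫⁻ y in ball (0 : EuclideanSpace ℝ (Fin 3)) R, ‖mollify η ε U s y‖ₑ ^ q
      = ∫⁻ y in ball (0 : EuclideanSpace ℝ (Fin 3)) R, ‖mollify η ε V s y‖ₑ ^ q := by
        refine setLIntegral_congr_fun measurableSet_ball fun y hy => ?_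
        rw [mollify_apply_eq_mollify_indicator hρ hε hερ U hy]
    _ ≤ ∫⁻ y, ‖mollify η ε V s y‖ₑ ^ q := setLIntegral_le_lintegral _ _
    _ ≤ (∫⁻ y, ‖BradshawTsai2019.scaledMollifier η ε y‖ₑ) ^ q * ∫⁻ y, ‖V s y‖ₑ ^ q :=
        UnboundedOperators.lintegral_rpow_enorm_convolution_le
          (hη.continuous_scaledMollifier ε).aestronglyMeasurable hVs hq
    _ = (∫⁻ y, ‖η y‖ₑ) ^ q * ∫⁻ y in ball (0 : EuclideanSpace ℝ (Fin 3)) (R + 1), ‖U s y‖ₑ ^ q := by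
        rw [hη.lintegral_enorm_scaledMollifier hε, ← lintegral_indicator measurableSet_ball]
        congr 1
        refine lintegral_congr fun y => ?_
        rw [hV]
        dsimp only
        by_cases hy : y ∈ ball (0 : EuclideanSpace ℝ (Fin 3)) (R + 1)
        · rw [indicator_of_mem hy, indicator_of_mem hy]
        · rw [indicator_of_notMem hy, indicator_of_notMem hy, enorm_zero,
            ENNReal.zero_rpow_of_pos (one_pos.trans_le hq)]

/-- **The global Young inequality for one slice**: `∫ |η_ε * f|^q ≤ ‖η‖₁^q ∫ |f|^q`. [folklore] -/
theorem lintegral_mollify_rpow_le (hη : IsMollifyingKernel η) {ε : ℝ} (hε : 0 < ε)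
    {U : ℝ → EuclideanSpace ℝ (Fin 3) → EuclideanSpace ℝ (Fin 3)} {s : ℝ}
    (hUs : AEStronglyMeasurable (U s) (volume : Measure (EuclideanSpace ℝ (Fin 3)))) {q : ℝ} (hq : 1 ≤ q) :
    ∫⁻ y, ‖mollify η ε U s y‖ₑ ^ q ≤ (∫⁻ y, ‖η y‖ₑ) ^ q * ∫⁻ y, ‖U s y‖ₑ ^ q := by
  have h := UnboundedOperators.lintegral_rpow_enorm_convolution_le (μ := volume)
    (hη.continuous_scaledMollifier ε).aestronglyMeasurable hUs hq
  rwa [hη.lintegral_enorm_scaledMollifier hε] at h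

/-- **The convolution integrand is integrable** for a slice in `L²(ℝ³)`:
`t ↦ η_ε(t) f(y − t)` is integrable for every `y` (Hölder `L² · L²`). [folklore] -/
theorem IsMollifyingKernel.integrable_smul_comp_sub (hη : IsMollifyingKernel η) {ε : ℝ} (hε : 0 < ε)
    {f : EuclideanSpace ℝ (Fin 3) → EuclideanSpace ℝ (Fin 3)} (hf : MemLp f 2 (volume : Measure (EuclideanSpace ℝ (Fin 3))))
    (y : EuclideanSpace ℝ (Fin 3)) :
    Integrable (fun t => BradshawTsai2019.scaledMollifier η ε t • f (y - t))
      (volume : Measure (EuclideanSpace ℝ (Fin 3))) := by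
  have h1 : MemLp (fun t => f (y - t)) 2 (volume : Measure (EuclideanSpace ℝ (Fin 3))) :=
    hf.comp_measurePreserving (Measure.measurePreserving_sub_left volume y)
  have h2 : MemLp (BradshawTsai2019.scaledMollifier η ε) 2 (volume : Measure (EuclideanSpace ℝ (Fin 3))) := by
    obtain ⟨ρ, -, hρ⟩ := hη.exists_support_radius
    exact (hη.continuous_scaledMollifier ε).memLp_of_hasCompactSupport
      (BradshawTsai2019.hasCompactSupport_scaledMollifier hρ hε)
  have h3 : MemLp (fun t => BradshawTsai2019.scaledMollifier η ε t • f (y - t)) 1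
      (volume : Measure (EuclideanSpace ℝ (Fin 3))) := h1.smul h2
  exact memLp_one_iff_integrable.1 h3

/-- **The mollification is linear** on slices in `L²`:
`η_ε * (U − V)(s) = η_ε * U(s) − η_ε * V(s)` pointwise (`ε > 0`). [folklore] -/
theorem mollify_sub_apply (hη : IsMollifyingKernel η) {ε : ℝ} (hε : 0 < ε)
    {U V : ℝ → EuclideanSpace ℝ (Fin 3) → EuclideanSpace ℝ (Fin 3)} {s : ℝ}
    (hU : MemLp (U s) 2 (volume : Measure (EuclideanSpace ℝ (Fin 3))))
    (hV : MemLp (V s) 2 (volume : Measure (EuclideanSpace ℝ (Fin 3)))) (y : EuclideanSpace ℝ (Fin 3)) :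
    mollify η ε (fun s y => U s y - V s y) s y = mollify η ε U s y - mollify η ε V s y := by
  rw [mollify_apply, mollify_apply, mollify_apply,
    ← integral_sub (hη.integrable_smul_comp_sub hε hU y) (hη.integrable_smul_comp_sub hε hV y)]
  refine integral_congr_ae (Eventually.of_forall fun t => ?_)
  simp only [smul_sub]

end Slice

/-! ### The Young inequalities on cylinders (Tonelli) -/

section Cylinder

variable {η : EuclideanSpace ℝ (Fin 3) → ℝ}

/-- Tonelli on a cylinder `S × B` for `‖F‖ₑ^q`. [folklore] -/
theorem setLIntegral_prod_enorm_rpow_eq {F : ℝ × EuclideanSpace ℝ (Fin 3) → EuclideanSpace ℝ (Fin 3)}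
    (hF : AEStronglyMeasurable F (volume : Measure (ℝ × EuclideanSpace ℝ (Fin 3)))) (q : ℝ) (S : Set ℝ)
    (B : Set (EuclideanSpace ℝ (Fin 3))) :
    ∫⁻ z in S ×ˢ B, ‖F z‖ₑ ^ q = ∫⁻ s in S, ∫⁻ y in B, ‖F (s, y)‖ₑ ^ q := by
  have hm : AEMeasurable (fun z => ‖F z‖ₑ ^ q)
      (((volume : Measure ℝ).restrict S).prod ((volume : Measure (EuclideanSpace ℝ (Fin 3))).restrict B)) := by
    rw [← FunctionSpaces.AubinLions.volume_restrict_prod]; exact (hF.restrict.enorm.pow_const q)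
  rw [FunctionSpaces.AubinLions.volume_restrict_prod, lintegral_prod _ hm]

/-- **The local Young inequality on cylinders**: for `ερ ≤ 1`, `1 ≤ q` and a jointly measurable
`U`, `∫∫_{S×B(0,R)} |η_ε * U|^q ≤ ‖η‖₁^q ∫∫_{S×B(0,R+1)} |U|^q` (Tonelli and the one-slice
inequality `setLIntegral_mollify_rpow_le`). [folklore] -/
theorem setLIntegral_cylinder_mollify_rpow_le (hη : IsMollifyingKernel η) {ρ : ℝ}
    (hρ : ∀ y : EuclideanSpace ℝ (Fin 3), ρ ≤ ‖y‖ → η y = 0) {ε : ℝ} (hε : 0 < ε) (hερ : ε * ρ ≤ 1)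
    {U : ℝ → EuclideanSpace ℝ (Fin 3) → EuclideanSpace ℝ (Fin 3)}
    (hUm : AEStronglyMeasurable (uncurry U) (volume : Measure (ℝ × EuclideanSpace ℝ (Fin 3)))) {q : ℝ} (hq : 1 ≤ q)
    (S : Set ℝ) (R : ℝ) :
    ∫⁻ z in S ×ˢ ball (0 : EuclideanSpace ℝ (Fin 3)) R, ‖mollify η ε U z.1 z.2‖ₑ ^ q ≤
      (∫⁻ y, ‖η y‖ₑ) ^ q * ∫⁻ z in S ×ˢ ball (0 : EuclideanSpace ℝ (Fin 3)) (R + 1), ‖U z.1 z.2‖ₑ ^ q := by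
  have hmm : AEStronglyMeasurable (uncurry (mollify η ε U)) (volume : Measure (ℝ × EuclideanSpace ℝ (Fin 3))) :=
    hη.aestronglyMeasurable_mollify ε hUm
  have hslice : ∀ᵐ s : ℝ, AEStronglyMeasurable (U s) (volume : Measure (EuclideanSpace ℝ (Fin 3))) := by
    have h1 := hUm
    rw [Measure.volume_eq_prod] at h1
    exact h1.prodMk_left
  change ∫⁻ z in S ×ˢ ball (0 : EuclideanSpace ℝ (Fin 3)) R, ‖uncurry (mollify η ε U) z‖ₑ ^ q ≤
    (∫⁻ y, ‖η y‖ₑ) ^ q * ∫⁻ z in S ×ˢ ball (0 : EuclideanSpace ℝ (Fin 3)) (R + 1), ‖uncurry U z‖ₑ ^ q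
  rw [setLIntegral_prod_enorm_rpow_eq hmm, setLIntegral_prod_enorm_rpow_eq hUm]
  have hIm : AEMeasurable (fun s => ∫⁻ y in ball (0 : EuclideanSpace ℝ (Fin 3)) (R + 1), ‖uncurry U (s, y)‖ₑ ^ q)
      ((volume : Measure ℝ).restrict S) := by
    have hm : AEMeasurable (fun z => ‖uncurry U z‖ₑ ^ q)
        (((volume : Measure ℝ).restrict S).prod
          ((volume : Measure (EuclideanSpace ℝ (Fin 3))).restrict (ball (0 : EuclideanSpace ℝ (Fin 3)) (R + 1)))) := by
      rw [← FunctionSpaces.AubinLions.volume_restrict_prod]; exact (hUm.restrict.enorm.pow_const q)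
    exact hm.lintegral_prod_right'
  rw [← lintegral_const_mul'' _ hIm]
  refine lintegral_mono_ae ?_
  filter_upwards [ae_restrict_of_ae hslice] with s hs
  exact setLIntegral_mollify_rpow_le hη hρ hε hερ hs hq R

/-- **The global Young inequality on space–time**: for `1 ≤ q` and a jointly measurable `U`,
`∫∫ |η_ε * U|^q ≤ ‖η‖₁^q ∫∫ |U|^q`. [folklore] -/
theorem lintegral_spaceTime_mollify_rpow_le (hη : IsMollifyingKernel η) {ε : ℝ} (hε : 0 < ε)
    {U : ℝ → EuclideanSpace ℝ (Fin 3) → EuclideanSpace ℝ (Fin 3)}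
    (hUm : AEStronglyMeasurable (uncurry U) (volume : Measure (ℝ × EuclideanSpace ℝ (Fin 3)))) {q : ℝ} (hq : 1 ≤ q) :
    ∫⁻ z : ℝ × EuclideanSpace ℝ (Fin 3), ‖mollify η ε U z.1 z.2‖ₑ ^ q ≤
      (∫⁻ y, ‖η y‖ₑ) ^ q * ∫⁻ z : ℝ × EuclideanSpace ℝ (Fin 3), ‖U z.1 z.2‖ₑ ^ q := by
  have hmm : AEStronglyMeasurable (uncurry (mollify η ε U)) (volume : Measure (ℝ × EuclideanSpace ℝ (Fin 3))) :=
    hη.aestronglyMeasurable_mollify ε hUm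
  have hslice : ∀ᵐ s : ℝ, AEStronglyMeasurable (U s) (volume : Measure (EuclideanSpace ℝ (Fin 3))) := by
    have h1 := hUm
    rw [Measure.volume_eq_prod] at h1
    exact h1.prodMk_left
  change ∫⁻ z : ℝ × EuclideanSpace ℝ (Fin 3), ‖uncurry (mollify η ε U) z‖ₑ ^ q ≤
    (∫⁻ y, ‖η y‖ₑ) ^ q * ∫⁻ z : ℝ × EuclideanSpace ℝ (Fin 3), ‖uncurry U z‖ₑ ^ q
  have hm1 : AEMeasurable (fun z => ‖uncurry (mollify η ε U) z‖ₑ ^ q)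
      ((volume : Measure ℝ).prod (volume : Measure (EuclideanSpace ℝ (Fin 3)))) := by
    rw [← Measure.volume_eq_prod]; exact hmm.enorm.pow_const q
  have hm2 : AEMeasurable (fun z => ‖uncurry U z‖ₑ ^ q)
      ((volume : Measure ℝ).prod (volume : Measure (EuclideanSpace ℝ (Fin 3)))) := by
    rw [← Measure.volume_eq_prod]; exact hUm.enorm.pow_const q
  rw [Measure.volume_eq_prod, lintegral_prod _ hm1, lintegral_prod _ hm2,
    ← lintegral_const_mul'' _ hm2.lintegral_prod_right']
  refine lintegral_mono_ae ?_
  filter_upwards [hslice] with s hs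
  exact lintegral_mollify_rpow_le hη hε hs hq

/-- `(3 : ℝ≥0∞).toReal = 3`. [folklore] -/
theorem toReal_three : (3 : ℝ≥0∞).toReal = 3 := ENNReal.toReal_ofNat 3

/-- `‖f‖_{L³} = (∫⁻ ‖f‖ₑ³)^{1/3}`. [folklore] -/
theorem eLpNorm_three_eq_rpow {X : Type*} [MeasurableSpace X] {μ : Measure X} {F : Type*} [NormedAddCommGroup F]
    (f : X → F) : eLpNorm f 3 μ = (∫⁻ x, ‖f x‖ₑ ^ (3 : ℝ) ∂μ) ^ (1 / 3 : ℝ) := by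
  rw [eLpNorm_eq_lintegral_rpow_enorm_toReal (by norm_num) (by norm_num), toReal_three]

/-- `(c³ A)^{1/3} = c A^{1/3}` in `ℝ≥0∞`. [folklore] -/
theorem rpow_three_mul_rpow_third (c A : ℝ≥0∞) : (c ^ (3 : ℝ) * A) ^ (1 / 3 : ℝ) = c * A ^ (1 / 3 : ℝ) := by
  rw [ENNReal.mul_rpow_of_nonneg _ _ (by norm_num), ← ENNReal.rpow_mul]
  norm_num

/-- **The local Young inequality on cylinders in `L³` form**: for `ερ ≤ 1`,
`‖η_ε * U‖_{L³(S×B(0,R))} ≤ ‖η‖₁ ‖U‖_{L³(S×B(0,R+1))}`. [folklore] -/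
theorem eLpNorm_cylinder_mollify_le (hη : IsMollifyingKernel η) {ρ : ℝ}
    (hρ : ∀ y : EuclideanSpace ℝ (Fin 3), ρ ≤ ‖y‖ → η y = 0) {ε : ℝ} (hε : 0 < ε) (hερ : ε * ρ ≤ 1)
    {U : ℝ → EuclideanSpace ℝ (Fin 3) → EuclideanSpace ℝ (Fin 3)}
    (hUm : AEStronglyMeasurable (uncurry U) (volume : Measure (ℝ × EuclideanSpace ℝ (Fin 3)))) (S : Set ℝ) (R : ℝ) :
    eLpNorm (fun z : ℝ × EuclideanSpace ℝ (Fin 3) => mollify η ε U z.1 z.2) 3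
        (volume.restrict (S ×ˢ ball (0 : EuclideanSpace ℝ (Fin 3)) R)) ≤
      (∫⁻ y, ‖η y‖ₑ) * eLpNorm (uncurry U) 3 (volume.restrict (S ×ˢ ball (0 : EuclideanSpace ℝ (Fin 3)) (R + 1))) := by
  rw [eLpNorm_three_eq_rpow, eLpNorm_three_eq_rpow, ← rpow_three_mul_rpow_third]
  exact ENNReal.rpow_le_rpow (setLIntegral_cylinder_mollify_rpow_le hη hρ hε hερ hUm (by norm_num) S R)
    (by norm_num)

/-- **The global Young inequality in `L³` form**: `‖η_ε * U‖_{L³(ℝ×ℝ³)} ≤ ‖η‖₁ ‖U‖_{L³(ℝ×ℝ³)}`.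
[folklore] -/
theorem eLpNorm_spaceTime_mollify_le (hη : IsMollifyingKernel η) {ε : ℝ} (hε : 0 < ε)
    {U : ℝ → EuclideanSpace ℝ (Fin 3) → EuclideanSpace ℝ (Fin 3)}
    (hUm : AEStronglyMeasurable (uncurry U) (volume : Measure (ℝ × EuclideanSpace ℝ (Fin 3)))) :
    eLpNorm (fun z : ℝ × EuclideanSpace ℝ (Fin 3) => mollify η ε U z.1 z.2) 3 volume ≤
      (∫⁻ y, ‖η y‖ₑ) * eLpNorm (uncurry U) 3 volume := by
  rw [eLpNorm_three_eq_rpow, eLpNorm_three_eq_rpow, ← rpow_three_mul_rpow_third]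
  exact ENNReal.rpow_le_rpow (lintegral_spaceTime_mollify_rpow_le hη hε hUm (by norm_num)) (by norm_num)

end Cylinder

/-! ### The approximate identity for a fixed field in `L³` of a cylinder -/

section ApproximateIdentity

variable {η : EuclideanSpace ℝ (Fin 3) → ℝ}

/-- **The cut-off of an `L³(S × B)` field is in `L³(ℝ × ℝ³)`.** [folklore] -/
theorem memLp_three_indicator_cylinder {V : ℝ → EuclideanSpace ℝ (Fin 3) → EuclideanSpace ℝ (Fin 3)}
    (hVm : AEStronglyMeasurable (uncurry V) (volume : Measure (ℝ × EuclideanSpace ℝ (Fin 3))))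
    {S : Set ℝ} (hS : MeasurableSet S) {R' : ℝ}
    (hV3 : ∫⁻ z in S ×ˢ ball (0 : EuclideanSpace ℝ (Fin 3)) R', ‖V z.1 z.2‖ₑ ^ (3 : ℝ) < ∞) :
    MemLp ((S ×ˢ ball (0 : EuclideanSpace ℝ (Fin 3)) R').indicator (uncurry V)) 3
      (volume : Measure (ℝ × EuclideanSpace ℝ (Fin 3))) := by
  rw [memLp_indicator_iff_restrict (hS.prod measurableSet_ball)]
  refine ⟨hVm.restrict, ?_⟩
  rw [eLpNorm_three_eq_rpow]
  exact ENNReal.rpow_lt_top_of_nonneg (by norm_num) hV3.ne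

/-- **Almost every slice of the cut-off field is in `L²(ℝ³)`** (Tonelli: a.e. slice is in
`L³(B)`, and `L³(B) ⊂ L²(B)` on the ball). [folklore] -/
theorem ae_memLp_two_slice_indicator_cylinder {V : ℝ → EuclideanSpace ℝ (Fin 3) → EuclideanSpace ℝ (Fin 3)}
    (hVm : AEStronglyMeasurable (uncurry V) (volume : Measure (ℝ × EuclideanSpace ℝ (Fin 3))))
    {S : Set ℝ} (hS : MeasurableSet S) {R' : ℝ}
    (hV3 : ∫⁻ z in S ×ˢ ball (0 : EuclideanSpace ℝ (Fin 3)) R', ‖V z.1 z.2‖ₑ ^ (3 : ℝ) < ∞) :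
    ∀ᵐ s : ℝ, MemLp (fun y => (S ×ˢ ball (0 : EuclideanSpace ℝ (Fin 3)) R').indicator (uncurry V) (s, y)) 2
      (volume : Measure (EuclideanSpace ℝ (Fin 3))) := by
  have hmem := memLp_three_indicator_cylinder hVm hS hV3
  set Vq : ℝ × EuclideanSpace ℝ (Fin 3) → EuclideanSpace ℝ (Fin 3) :=
    (S ×ˢ ball (0 : EuclideanSpace ℝ (Fin 3)) R').indicator (uncurry V) with hVq
  -- a.e. slice of `Vq` is measurable and has finite `L³` norm
  have hm : AEStronglyMeasurable Vq ((volume : Measure ℝ).prod (volume : Measure (EuclideanSpace ℝ (Fin 3)))) := by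
    rw [← Measure.volume_eq_prod]; exact hmem.1
  have h3 : ∫⁻ z, ‖Vq z‖ₑ ^ (3 : ℝ) ∂((volume : Measure ℝ).prod (volume : Measure (EuclideanSpace ℝ (Fin 3)))) < ∞ := by
    rw [← Measure.volume_eq_prod]
    have := hmem.2
    rw [eLpNorm_three_eq_rpow] at this
    exact lt_top_iff_ne_top.2 fun h => by
      rw [h, ENNReal.top_rpow_of_pos (by norm_num)] at this; exact lt_irrefl _ this
  rw [lintegral_prod _ (hm.enorm.pow_const _)] at h3
  have hslice_fin : ∀ᵐ s : ℝ, ∫⁻ y, ‖Vq (s, y)‖ₑ ^ (3 : ℝ) < ∞ :=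
    ae_lt_top' (hm.enorm.pow_const _).lintegral_prod_right' h3.ne
  filter_upwards [hm.prodMk_left, hslice_fin] with s hsm hsf
  -- the slice is supported in the ball, in `L³`, hence in `L²`
  have h3s : MemLp (fun y => Vq (s, y)) 3 (volume : Measure (EuclideanSpace ℝ (Fin 3))) := by
    refine ⟨hsm, ?_⟩
    rw [eLpNorm_three_eq_rpow]
    exact ENNReal.rpow_lt_top_of_nonneg (by norm_num) hsf.ne
  have hsupp : (fun y => Vq (s, y)) = (ball (0 : EuclideanSpace ℝ (Fin 3)) R').indicator (fun y => Vq (s, y)) := by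
    funext y
    by_cases hy : y ∈ ball (0 : EuclideanSpace ℝ (Fin 3)) R'
    · rw [indicator_of_mem hy]
    · rw [indicator_of_notMem hy, hVq, indicator_of_notMem (fun h => hy h.2)]
  rw [hsupp] at h3s ⊢
  rw [memLp_indicator_iff_restrict measurableSet_ball] at h3s ⊢
  haveI : IsFiniteMeasure ((volume : Measure (EuclideanSpace ℝ (Fin 3))).restrict (ball (0 : EuclideanSpace ℝ (Fin 3)) R')) :=
    ⟨by rw [Measure.restrict_apply_univ]; exact measure_ball_lt_top⟩
  exact h3s.mono_exponent (by norm_num)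

/-- **The mollification of a continuous compactly supported field stays uniformly close** and
**supported near the support**: if `‖Ψ z − Ψ z'‖ ≤ γ` whenever `dist z z' < θ`, then for
`ερ < θ`, `ερ ≤ 1`, at every point `‖(η_ε * Ψ(s))(y) − Ψ(s, y)‖ ≤ γ ∫‖η‖`, and the difference
vanishes off the closed `1`-thickening of `tsupport Ψ`. [folklore] -/
theorem norm_mollify_sub_self_le_of_continuous (hη : IsMollifyingKernel η) {ρ : ℝ}
    (hρ : ∀ y : EuclideanSpace ℝ (Fin 3), ρ ≤ ‖y‖ → η y = 0) {ε : ℝ} (hε : 0 < ε) (hερ : ε * ρ ≤ 1)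
    {Ψ : ℝ × EuclideanSpace ℝ (Fin 3) → EuclideanSpace ℝ (Fin 3)} (hΨc : Continuous Ψ) (hΨs : HasCompactSupport Ψ)
    {γ θ : ℝ} (hθ : ε * ρ < θ)
    (hmod : ∀ z z' : ℝ × EuclideanSpace ℝ (Fin 3), dist z z' < θ → ‖Ψ z - Ψ z'‖ ≤ γ)
    (z : ℝ × EuclideanSpace ℝ (Fin 3)) :
    ‖mollify η ε (fun s y => Ψ (s, y)) z.1 z.2 - Ψ z‖ ≤ γ * ∫ t, ‖η t‖ ∧
    (z ∉ cthickening 1 (tsupport Ψ) → mollify η ε (fun s y => Ψ (s, y)) z.1 z.2 - Ψ z = 0) := by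
  set K : EuclideanSpace ℝ (Fin 3) → ℝ := BradshawTsai2019.scaledMollifier η ε with hK
  have hKi : Integrable K (volume : Measure (EuclideanSpace ℝ (Fin 3))) := hη.integrable_scaledMollifier hε
  have hK1 : ∫ t, K t = 1 := by
    rw [hK, BradshawTsai2019.integral_scaledMollifier η hε, hη.integral_eq_one]
  have hKnorm : ∫ t, ‖K t‖ = ∫ t, ‖η t‖ := by
    rw [integral_norm_eq_lintegral_enorm hKi.1, integral_norm_eq_lintegral_enorm hη.integrable.1,
      hK, hη.lintegral_enorm_scaledMollifier hε]
  -- integrability of the convolution integrand (continuous field)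
  have hΨ2 : MemLp (fun y => Ψ (z.1, y)) 2 (volume : Measure (EuclideanSpace ℝ (Fin 3))) := by
    have hc : Continuous fun y => Ψ (z.1, y) := hΨc.comp (continuous_const.prodMk continuous_id)
    have hs : HasCompactSupport fun y => Ψ (z.1, y) := by
      refine HasCompactSupport.intro (hΨs.image continuous_snd) fun y hy => ?_
      by_contra h
      exact hy ⟨(z.1, y), subset_tsupport _ (Function.mem_support.2 h), rfl⟩
    exact hc.memLp_of_hasCompactSupport hs
  have hint1 : Integrable (fun t => K t • Ψ (z.1, z.2 - t)) (volume : Measure (EuclideanSpace ℝ (Fin 3))) :=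
    hη.integrable_smul_comp_sub hε hΨ2 z.2
  have hint2 : Integrable (fun t => K t • Ψ z) (volume : Measure (EuclideanSpace ℝ (Fin 3))) := hKi.smul_const _
  -- the difference as one integral
  have hdiff : mollify η ε (fun s y => Ψ (s, y)) z.1 z.2 - Ψ z = ∫ t, K t • (Ψ (z.1, z.2 - t) - Ψ z) := by
    rw [mollify_apply]
    have e : Ψ z = ∫ t, K t • Ψ z := by rw [integral_smul_const, hK1, one_smul]
    conv_lhs => rw [e]
    rw [← integral_sub hint1 hint2]
    refine integral_congr_ae (Eventually.of_forall fun t => ?_)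
    show K t • Ψ (z.1, z.2 - t) - K t • Ψ z = K t • (Ψ (z.1, z.2 - t) - Ψ z)
    rw [smul_sub]
  constructor
  · rw [hdiff, ← hKnorm]
    have hg : Integrable (fun t => γ * ‖K t‖) (volume : Measure (EuclideanSpace ℝ (Fin 3))) := hKi.norm.const_mul γ
    calc ‖∫ t, K t • (Ψ (z.1, z.2 - t) - Ψ z)‖ ≤ ∫ t, γ * ‖K t‖ := by
          refine norm_integral_le_of_norm_le hg (Eventually.of_forall fun t => ?_)
          by_cases ht : K t = 0
          · rw [ht, zero_smul, norm_zero, norm_zero, mul_zero]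
          · rw [norm_smul, mul_comm]
            refine mul_le_mul_of_nonneg_right (hmod _ _ ?_) (norm_nonneg _)
            have hn : ‖t‖ < ε * ρ := norm_lt_of_scaledMollifier_ne_zero hρ hε ht
            rw [Prod.dist_eq, dist_self, dist_eq_norm, sub_sub_cancel_left, norm_neg]
            exact max_lt (lt_of_le_of_lt (norm_nonneg t) (hn.trans hθ)) (hn.trans hθ)
      _ = γ * ∫ t, ‖K t‖ := MeasureTheory.integral_const_mul _ _
  · intro hz
    rw [hdiff]
    have hzero : ∀ t, K t • (Ψ (z.1, z.2 - t) - Ψ z) = 0 := by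
      intro t
      by_cases ht : K t = 0
      · rw [ht, zero_smul]
      · have hn : ‖t‖ < ε * ρ := norm_lt_of_scaledMollifier_ne_zero hρ hε ht
        have hΨz : Ψ z = 0 := image_eq_zero_of_notMem_tsupport fun h => hz (self_subset_cthickening _ h)
        have hΨt : Ψ (z.1, z.2 - t) = 0 := by
          refine image_eq_zero_of_notMem_tsupport fun h => hz ?_
          refine mem_cthickening_of_dist_le z (z.1, z.2 - t) 1 _ h ?_
          rw [Prod.dist_eq, dist_self, dist_eq_norm, sub_sub_cancel, max_eq_right (norm_nonneg _)]
          linarith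
        rw [hΨz, hΨt, sub_zero, smul_zero]
    simp only [hzero, integral_zero]

/-- **The approximate identity in `L³` of a cylinder, for a fixed field**: if `V` is jointly
measurable with `∫∫_{(a,b)×B(0,R+1)} |V|³ < ∞` and `ε_k → 0⁺`, then
`‖η_{ε_k} * V − V‖_{L³((a,b)×B(0,R))} → 0` (density of continuous compactly supported fields in
`L³(ℝ × ℝ³)`, uniform continuity, and the Young inequalities; Evans, *PDE*, App. C.4, Thm. 7).
[folklore] -/
theorem tendsto_eLpNorm_mollify_sub_self (hη : IsMollifyingKernel η)
    {V : ℝ → EuclideanSpace ℝ (Fin 3) → EuclideanSpace ℝ (Fin 3)}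
    (hVm : AEStronglyMeasurable (uncurry V) (volume : Measure (ℝ × EuclideanSpace ℝ (Fin 3)))) {a b R : ℝ}
    (hV3 : ∫⁻ z in Ioo a b ×ˢ ball (0 : EuclideanSpace ℝ (Fin 3)) (R + 1), ‖V z.1 z.2‖ₑ ^ (3 : ℝ) < ∞)
    {ε : ℕ → ℝ} (hε : ∀ k, 0 < ε k) (hε0 : Tendsto ε atTop (𝓝 0)) :
    Tendsto (fun k => eLpNorm (fun z : ℝ × EuclideanSpace ℝ (Fin 3) => mollify η (ε k) V z.1 z.2 - V z.1 z.2) 3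
      (volume.restrict (Ioo a b ×ˢ ball (0 : EuclideanSpace ℝ (Fin 3)) R))) atTop (𝓝 0) := by
  obtain ⟨ρ, hρ0, hρ⟩ := hη.exists_support_radius
  set L : ℝ≥0∞ := ∫⁻ y, ‖η y‖ₑ with hL
  have hLtop : L ≠ ∞ := hη.lintegral_enorm_lt_top.ne
  -- notation
  set S : Set (ℝ × EuclideanSpace ℝ (Fin 3)) := Ioo a b ×ˢ ball (0 : EuclideanSpace ℝ (Fin 3)) (R + 1) with hS
  set Q : Set (ℝ × EuclideanSpace ℝ (Fin 3)) := Ioo a b ×ˢ ball (0 : EuclideanSpace ℝ (Fin 3)) R with hQ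
  have hSm : MeasurableSet S := measurableSet_Ioo.prod measurableSet_ball
  have hQm : MeasurableSet Q := measurableSet_Ioo.prod measurableSet_ball
  set Vq : ℝ × EuclideanSpace ℝ (Fin 3) → EuclideanSpace ℝ (Fin 3) := S.indicator (uncurry V) with hVq
  set Vc : ℝ → EuclideanSpace ℝ (Fin 3) → EuclideanSpace ℝ (Fin 3) := fun s y => Vq (s, y) with hVc
  have hVcunc : uncurry Vc = Vq := by funext z; rfl
  have hVqmem : MemLp Vq 3 (volume : Measure (ℝ × EuclideanSpace ℝ (Fin 3))) := memLp_three_indicator_cylinder hVm measurableSet_Ioo hV3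
  have hVqm : AEStronglyMeasurable Vq (volume : Measure (ℝ × EuclideanSpace ℝ (Fin 3))) := hVqmem.1
  have hVc2 : ∀ᵐ s : ℝ, MemLp (Vc s) 2 (volume : Measure (EuclideanSpace ℝ (Fin 3))) :=
    ae_memLp_two_slice_indicator_cylinder hVm measurableSet_Ioo hV3
  -- on `Q`, the mollification of `V` is the mollification of `Vc` (for `ερ ≤ 1`), and `V = Vq`
  have hloc : ∀ {e : ℝ}, 0 < e → e * ρ ≤ 1 → ∀ z ∈ Q, mollify η e V z.1 z.2 - V z.1 z.2 =
      mollify η e Vc z.1 z.2 - Vq z := by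
    intro e he heρ z hz
    have h1 : mollify η e V z.1 z.2 = mollify η e Vc z.1 z.2 := by
      refine mollify_apply_congr_of_ball hρ he fun w hw => ?_
      have hw' : w ∈ ball (0 : EuclideanSpace ℝ (Fin 3)) (R + 1) := by
        have hy : ‖z.2‖ < R := by simpa using hz.2
        rw [mem_ball, dist_eq_norm] at hw
        rw [mem_ball_zero_iff]
        calc ‖w‖ = ‖(w - z.2) + z.2‖ := by rw [sub_add_cancel]
          _ ≤ ‖w - z.2‖ + ‖z.2‖ := norm_add_le _ _
          _ < 1 + R := by linarith
          _ = R + 1 := add_comm _ _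
      rw [hVc]
      dsimp only
      rw [hVq, indicator_of_mem (show (z.1, w) ∈ S from ⟨hz.1, hw'⟩)]
      rfl
    have h2 : V z.1 z.2 = Vq z := by
      rw [hVq, indicator_of_mem (show z ∈ S from ⟨hz.1, ball_subset_ball (by linarith) hz.2⟩)]
      rfl
    rw [h1, h2]
  -- the `ε/2` bookkeeping
  rw [ENNReal.tendsto_atTop_zero]
  intro γ hγ
  have hγ2 : γ / 2 ≠ 0 := (ENNReal.half_pos hγ.ne').ne'
  -- `δ (L + 2) < γ/2`
  obtain ⟨δ, hδ0, hδ⟩ := ENNReal.exists_nnreal_pos_mul_lt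
    (ENNReal.add_ne_top.2 ⟨hLtop, ENNReal.ofNat_ne_top⟩ : L + 2 ≠ ∞) hγ2
  have hδ0' : (δ : ℝ≥0∞) ≠ 0 := by exact_mod_cast hδ0.ne'
  -- a continuous compactly supported `Ψ` with `‖Vq - Ψ‖₃ ≤ δ`
  obtain ⟨Ψ, hΨs, hΨδ, hΨc, hΨmem⟩ := hVqmem.exists_hasCompactSupport_eLpNorm_sub_le (by norm_num) hδ0'
  set Ψc : ℝ → EuclideanSpace ℝ (Fin 3) → EuclideanSpace ℝ (Fin 3) := fun s y => Ψ (s, y) with hΨcdef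
  have hΨcunc : uncurry Ψc = Ψ := by funext z; rfl
  have hΨ2 : ∀ s, MemLp (Ψc s) 2 (volume : Measure (EuclideanSpace ℝ (Fin 3))) := by
    intro s
    have hc : Continuous fun y => Ψ (s, y) := hΨc.comp (continuous_const.prodMk continuous_id)
    have hs : HasCompactSupport fun y => Ψ (s, y) := by
      refine HasCompactSupport.intro (hΨs.image continuous_snd) fun y hy => ?_
      by_contra h
      exact hy ⟨(s, y), subset_tsupport _ (Function.mem_support.2 h), rfl⟩
    exact hc.memLp_of_hasCompactSupport hs
  -- the compact set carrying `η_ε * Ψ - Ψ`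
  set K₁ : Set (ℝ × EuclideanSpace ℝ (Fin 3)) := cthickening 1 (tsupport Ψ) with hK₁
  have hK₁c : IsCompact K₁ := hΨs.isCompact.cthickening
  have hK₁m : MeasurableSet K₁ := hK₁c.measurableSet
  have hvK : volume K₁ ^ (1 / 3 : ℝ) ≠ ∞ := ENNReal.rpow_ne_top_of_nonneg (by norm_num) hK₁c.measure_lt_top.ne
  -- `γ' (L vol(K₁)^{1/3}) < γ/2`
  obtain ⟨γ', hγ'0, hγ'⟩ := ENNReal.exists_nnreal_pos_mul_lt (ENNReal.mul_ne_top hLtop hvK) hγ2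
  -- uniform continuity of `Ψ` at tolerance `γ'`
  obtain ⟨θ, hθ0, hθ⟩ := Metric.uniformContinuous_iff.1 (hΨs.uniformContinuous_of_continuous hΨc) γ'
    (by exact_mod_cast hγ'0)
  -- eventually `ε k ρ < θ` and `ε k ρ ≤ 1`
  have hev : ∀ᶠ k in atTop, ε k * ρ < min θ 1 := by
    have h1 : Tendsto (fun k => ε k * ρ) atTop (𝓝 0) := by simpa using hε0.mul_const ρ
    exact (tendsto_order.1 h1).2 _ (lt_min hθ0 one_pos)
  obtain ⟨N, hN⟩ := eventually_atTop.1 hev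
  refine ⟨N, fun k hk => ?_⟩
  have hkθ : ε k * ρ < θ := (hN k hk).trans_le (min_le_left _ _)
  have hk1 : ε k * ρ ≤ 1 := ((hN k hk).trans_le (min_le_right _ _)).le
  -- rewrite on `Q`
  have hcongr : eLpNorm (fun z : ℝ × EuclideanSpace ℝ (Fin 3) => mollify η (ε k) V z.1 z.2 - V z.1 z.2) 3 (volume.restrict Q) =
      eLpNorm (fun z : ℝ × EuclideanSpace ℝ (Fin 3) => mollify η (ε k) Vc z.1 z.2 - Vq z) 3 (volume.restrict Q) := by
    refine eLpNorm_congr_ae ?_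
    filter_upwards [ae_restrict_mem hQm] with z hz
    exact hloc (hε k) hk1 z hz
  rw [hcongr]
  -- measurability of the three pieces
  have hmVc : AEStronglyMeasurable (fun z : ℝ × EuclideanSpace ℝ (Fin 3) => mollify η (ε k) Vc z.1 z.2) volume := by
    have := hη.aestronglyMeasurable_mollify (ε k) (U := Vc) (by rw [hVcunc]; exact hVqm)
    exact this
  have hmΨc : AEStronglyMeasurable (fun z : ℝ × EuclideanSpace ℝ (Fin 3) => mollify η (ε k) Ψc z.1 z.2) volume := by
    have := hη.aestronglyMeasurable_mollify (ε k) (U := Ψc) (by rw [hΨcunc]; exact hΨc.aestronglyMeasurable)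
    exact this
  have hmΨ : AEStronglyMeasurable Ψ (volume : Measure (ℝ × EuclideanSpace ℝ (Fin 3))) := hΨc.aestronglyMeasurable
  -- split into three pieces
  have hsplit : (fun z : ℝ × EuclideanSpace ℝ (Fin 3) => mollify η (ε k) Vc z.1 z.2 - Vq z) =
      (fun z => mollify η (ε k) Vc z.1 z.2 - mollify η (ε k) Ψc z.1 z.2) +
        ((fun z => mollify η (ε k) Ψc z.1 z.2 - Ψ z) + fun z => Ψ z - Vq z) := by
    funext z; simp only [Pi.add_apply]; abel
  rw [hsplit]
  have h3 : (1 : ℝ≥0∞) ≤ 3 := by norm_num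
  refine (eLpNorm_add_le ((hmVc.sub hmΨc).restrict) (((hmΨc.sub hmΨ).add (hmΨ.sub hVqm)).restrict) h3).trans ?_
  refine (add_le_add le_rfl (eLpNorm_add_le ((hmΨc.sub hmΨ).restrict) ((hmΨ.sub hVqm).restrict) h3)).trans ?_
  -- Term A: `‖η_ε * (Vc - Ψc)‖ ≤ L ‖Vq - Ψ‖ ≤ L δ`
  have hA : eLpNorm (fun z : ℝ × EuclideanSpace ℝ (Fin 3) => mollify η (ε k) Vc z.1 z.2 - mollify η (ε k) Ψc z.1 z.2) 3
      (volume.restrict Q) ≤ L * δ := by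
    have hlin : (fun z : ℝ × EuclideanSpace ℝ (Fin 3) => mollify η (ε k) Vc z.1 z.2 - mollify η (ε k) Ψc z.1 z.2) =ᵐ[volume]
        fun z => mollify η (ε k) (fun s y => Vc s y - Ψc s y) z.1 z.2 := by
      have h1 : ∀ᵐ z : ℝ × EuclideanSpace ℝ (Fin 3) ∂((volume : Measure ℝ).prod (volume : Measure (EuclideanSpace ℝ (Fin 3)))),
          MemLp (Vc z.1) 2 (volume : Measure (EuclideanSpace ℝ (Fin 3))) :=
        Measure.quasiMeasurePreserving_fst.ae hVc2
      rw [Measure.volume_eq_prod]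
      filter_upwards [h1] with z hz
      exact (mollify_sub_apply hη (hε k) hz (hΨ2 z.1) z.2).symm
    calc eLpNorm (fun z : ℝ × EuclideanSpace ℝ (Fin 3) => mollify η (ε k) Vc z.1 z.2 - mollify η (ε k) Ψc z.1 z.2) 3 (volume.restrict Q)
        ≤ eLpNorm (fun z : ℝ × EuclideanSpace ℝ (Fin 3) => mollify η (ε k) Vc z.1 z.2 - mollify η (ε k) Ψc z.1 z.2) 3 volume :=
          eLpNorm_mono_measure _ Measure.restrict_le_self
      _ = eLpNorm (fun z : ℝ × EuclideanSpace ℝ (Fin 3) => mollify η (ε k) (fun s y => Vc s y - Ψc s y) z.1 z.2) 3 volume :=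
          eLpNorm_congr_ae hlin
      _ ≤ L * eLpNorm (uncurry fun s y => Vc s y - Ψc s y) 3 volume :=
          eLpNorm_spaceTime_mollify_le hη (hε k) (by
            have : uncurry (fun s y => Vc s y - Ψc s y) = Vq - Ψ := by funext z; rfl
            rw [this]; exact hVqm.sub hmΨ)
      _ = L * eLpNorm (Vq - Ψ) 3 volume := by rfl
      _ ≤ L * δ := mul_le_mul' le_rfl hΨδ
  -- Term B: `‖η_ε * Ψ - Ψ‖ ≤ γ' L vol(K₁)^{1/3}`
  have hB : eLpNorm (fun z : ℝ × EuclideanSpace ℝ (Fin 3) => mollify η (ε k) Ψc z.1 z.2 - Ψ z) 3 (volume.restrict Q) ≤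
      (γ' : ℝ≥0∞) * (L * volume K₁ ^ (1 / 3 : ℝ)) := by
    have hpt := fun z => norm_mollify_sub_self_le_of_continuous hη hρ (hε k) hk1 hΨc hΨs (γ := γ') hkθ
      (fun z z' hzz' => (hθ hzz').le) z
    have hle : ∀ z : ℝ × EuclideanSpace ℝ (Fin 3), ‖mollify η (ε k) Ψc z.1 z.2 - Ψ z‖ ≤
        ‖K₁.indicator (fun _ => (γ' : ℝ) * L.toReal) z‖ := by
      intro z
      by_cases hz : z ∈ K₁
      · rw [indicator_of_mem hz, Real.norm_eq_abs, abs_of_nonneg (by positivity)]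
        have h1 := (hpt z).1
        have hLreal : ∫ t, ‖η t‖ = L.toReal := by
          rw [integral_norm_eq_lintegral_enorm hη.integrable.1]
        rwa [hLreal] at h1
      · rw [(hpt z).2 hz, indicator_of_notMem hz, norm_zero, norm_zero]
    calc eLpNorm (fun z : ℝ × EuclideanSpace ℝ (Fin 3) => mollify η (ε k) Ψc z.1 z.2 - Ψ z) 3 (volume.restrict Q)
        ≤ eLpNorm (fun z : ℝ × EuclideanSpace ℝ (Fin 3) => mollify η (ε k) Ψc z.1 z.2 - Ψ z) 3 volume :=
          eLpNorm_mono_measure _ Measure.restrict_le_self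
      _ ≤ eLpNorm (K₁.indicator (fun _ => (γ' : ℝ) * L.toReal)) 3 volume := eLpNorm_mono hle
      _ = ‖(γ' : ℝ) * L.toReal‖ₑ * volume K₁ ^ (1 / (3 : ℝ≥0∞).toReal) := eLpNorm_indicator_const hK₁m (by norm_num) (by norm_num)
      _ = (γ' : ℝ≥0∞) * (L * volume K₁ ^ (1 / 3 : ℝ)) := by
          rw [toReal_three, Real.enorm_eq_ofReal (by positivity), ENNReal.ofReal_mul (by positivity),
            ENNReal.ofReal_coe_nnreal, ENNReal.ofReal_toReal hLtop, mul_assoc]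
  -- Term C
  have hC : eLpNorm (fun z : ℝ × EuclideanSpace ℝ (Fin 3) => Ψ z - Vq z) 3 (volume.restrict Q) ≤ δ := by
    calc eLpNorm (fun z : ℝ × EuclideanSpace ℝ (Fin 3) => Ψ z - Vq z) 3 (volume.restrict Q)
        ≤ eLpNorm (fun z : ℝ × EuclideanSpace ℝ (Fin 3) => Ψ z - Vq z) 3 volume := eLpNorm_mono_measure _ Measure.restrict_le_self
      _ = eLpNorm (Vq - Ψ) 3 volume := by rw [← eLpNorm_neg]; congr 1; funext z; simp
      _ ≤ δ := hΨδ
  -- assemble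
  calc eLpNorm (fun z : ℝ × EuclideanSpace ℝ (Fin 3) => mollify η (ε k) Vc z.1 z.2 - mollify η (ε k) Ψc z.1 z.2) 3 (volume.restrict Q) +
        (eLpNorm (fun z : ℝ × EuclideanSpace ℝ (Fin 3) => mollify η (ε k) Ψc z.1 z.2 - Ψ z) 3 (volume.restrict Q) +
          eLpNorm (fun z : ℝ × EuclideanSpace ℝ (Fin 3) => Ψ z - Vq z) 3 (volume.restrict Q))
      ≤ L * δ + ((γ' : ℝ≥0∞) * (L * volume K₁ ^ (1 / 3 : ℝ)) + δ) := add_le_add hA (add_le_add hB hC)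
    _ = (δ : ℝ≥0∞) * (L + 1) + (γ' : ℝ≥0∞) * (L * volume K₁ ^ (1 / 3 : ℝ)) := by ring
    _ ≤ (δ : ℝ≥0∞) * (L + 2) + (γ' : ℝ≥0∞) * (L * volume K₁ ^ (1 / 3 : ℝ)) := by
        gcongr
        norm_num
    _ ≤ γ / 2 + γ / 2 := add_le_add hδ.le hγ'.le
    _ = γ := ENNReal.add_halves γ

/-- **The mollified drift converges to the limit velocity in `L³` of every cylinder** ([BT1],
proof of Thm 2.4: the passage `ε_k → 0` in the drift `W + η_{ε_k} * U_{ε_k}`). Let `U_k, U` be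
jointly measurable with almost every slice in `L²(ℝ³)`, `∫∫_{(a,b)×B(0,R+1)} |U|³ < ∞`,
`U_k → U` in `L³((a,b) × B(0,R+1))`, and `ε_k → 0⁺`. Then
`η_{ε_k} * U_k → U` in `L³((a,b) × B(0,R))`:
`‖η_ε * U_k − U‖ ≤ ‖η‖₁ ‖U_k − U‖_{L³((a,b)×B(0,R+1))} + ‖η_ε * U − U‖_{L³((a,b)×B(0,R))}`. [cite: BradshawTsai2017AHP, proof of Thm 2.4 (limit ε → 0)] -/
theorem tendsto_eLpNorm_mollify_sub_limit (hη : IsMollifyingKernel η)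
    {U : ℕ → ℝ → EuclideanSpace ℝ (Fin 3) → EuclideanSpace ℝ (Fin 3)}
    {Ul : ℝ → EuclideanSpace ℝ (Fin 3) → EuclideanSpace ℝ (Fin 3)}
    (hUm : ∀ k, AEStronglyMeasurable (uncurry (U k)) (volume : Measure (ℝ × EuclideanSpace ℝ (Fin 3))))
    (hU2 : ∀ k, ∀ᵐ s : ℝ, MemLp (U k s) 2 (volume : Measure (EuclideanSpace ℝ (Fin 3))))
    (hUlm : AEStronglyMeasurable (uncurry Ul) (volume : Measure (ℝ × EuclideanSpace ℝ (Fin 3))))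
    (hUl2 : ∀ᵐ s : ℝ, MemLp (Ul s) 2 (volume : Measure (EuclideanSpace ℝ (Fin 3)))) {a b R : ℝ}
    (hUl3 : ∫⁻ z in Ioo a b ×ˢ ball (0 : EuclideanSpace ℝ (Fin 3)) (R + 1), ‖Ul z.1 z.2‖ₑ ^ (3 : ℝ) < ∞)
    (hconv : Tendsto (fun k => eLpNorm (fun z : ℝ × EuclideanSpace ℝ (Fin 3) => U k z.1 z.2 - Ul z.1 z.2) 3
      (volume.restrict (Ioo a b ×ˢ ball (0 : EuclideanSpace ℝ (Fin 3)) (R + 1)))) atTop (𝓝 0))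
    {ε : ℕ → ℝ} (hε : ∀ k, 0 < ε k) (hε0 : Tendsto ε atTop (𝓝 0)) :
    Tendsto (fun k => eLpNorm (fun z : ℝ × EuclideanSpace ℝ (Fin 3) => mollify η (ε k) (U k) z.1 z.2 - Ul z.1 z.2) 3
      (volume.restrict (Ioo a b ×ˢ ball (0 : EuclideanSpace ℝ (Fin 3)) R))) atTop (𝓝 0) := by
  obtain ⟨ρ, hρ0, hρ⟩ := hη.exists_support_radius
  set L : ℝ≥0∞ := ∫⁻ y, ‖η y‖ₑ with hL
  have hLtop : L ≠ ∞ := hη.lintegral_enorm_lt_top.ne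
  set Q : Set (ℝ × EuclideanSpace ℝ (Fin 3)) := Ioo a b ×ˢ ball (0 : EuclideanSpace ℝ (Fin 3)) R with hQ
  set Qp : Set (ℝ × EuclideanSpace ℝ (Fin 3)) := Ioo a b ×ˢ ball (0 : EuclideanSpace ℝ (Fin 3)) (R + 1) with hQp
  have h3 : (1 : ℝ≥0∞) ≤ 3 := by norm_num
  -- the approximate identity for the fixed limit
  have hself := tendsto_eLpNorm_mollify_sub_self hη hUlm hUl3 hε hε0 (R := R)
  -- eventually `ε k ρ ≤ 1`
  have hev : ∀ᶠ k in atTop, ε k * ρ ≤ 1 := by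
    have h1 : Tendsto (fun k => ε k * ρ) atTop (𝓝 0) := by simpa using hε0.mul_const ρ
    exact ((tendsto_order.1 h1).2 1 one_pos).mono fun k hk => hk.le
  -- measurability
  have hmk : ∀ k, AEStronglyMeasurable (fun z : ℝ × EuclideanSpace ℝ (Fin 3) => mollify η (ε k) (U k) z.1 z.2) volume :=
    fun k => hη.aestronglyMeasurable_mollify (ε k) (hUm k)
  have hml : ∀ k, AEStronglyMeasurable (fun z : ℝ × EuclideanSpace ℝ (Fin 3) => mollify η (ε k) Ul z.1 z.2) volume :=
    fun k => hη.aestronglyMeasurable_mollify (ε k) hUlm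
  -- the bound, eventually
  have hbound : ∀ᶠ k in atTop,
      eLpNorm (fun z : ℝ × EuclideanSpace ℝ (Fin 3) => mollify η (ε k) (U k) z.1 z.2 - Ul z.1 z.2) 3 (volume.restrict Q) ≤
        L * eLpNorm (fun z : ℝ × EuclideanSpace ℝ (Fin 3) => U k z.1 z.2 - Ul z.1 z.2) 3 (volume.restrict Qp) +
          eLpNorm (fun z : ℝ × EuclideanSpace ℝ (Fin 3) => mollify η (ε k) Ul z.1 z.2 - Ul z.1 z.2) 3 (volume.restrict Q) := by
    filter_upwards [hev] with k hk
    have hsplit : (fun z : ℝ × EuclideanSpace ℝ (Fin 3) => mollify η (ε k) (U k) z.1 z.2 - Ul z.1 z.2) =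
        (fun z => mollify η (ε k) (U k) z.1 z.2 - mollify η (ε k) Ul z.1 z.2) +
          fun z => mollify η (ε k) Ul z.1 z.2 - Ul z.1 z.2 := by
      funext z; simp only [Pi.add_apply]; abel
    rw [hsplit]
    refine (eLpNorm_add_le ((hmk k).sub (hml k)).restrict (((hml k).sub hUlm).restrict) h3).trans
      (add_le_add ?_ le_rfl)
    -- linearity a.e. and the local Young inequality
    have hlin : (fun z : ℝ × EuclideanSpace ℝ (Fin 3) => mollify η (ε k) (U k) z.1 z.2 - mollify η (ε k) Ul z.1 z.2) =ᵐ[volume]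
        fun z => mollify η (ε k) (fun s y => U k s y - Ul s y) z.1 z.2 := by
      have h1 : ∀ᵐ z : ℝ × EuclideanSpace ℝ (Fin 3) ∂((volume : Measure ℝ).prod (volume : Measure (EuclideanSpace ℝ (Fin 3)))),
          MemLp (U k z.1) 2 (volume : Measure (EuclideanSpace ℝ (Fin 3))) ∧ MemLp (Ul z.1) 2 (volume : Measure (EuclideanSpace ℝ (Fin 3))) :=
        Measure.quasiMeasurePreserving_fst.ae ((hU2 k).and hUl2)
      rw [Measure.volume_eq_prod]
      filter_upwards [h1] with z hz
      exact (mollify_sub_apply hη (hε k) hz.1 hz.2 z.2).symm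
    calc eLpNorm (fun z : ℝ × EuclideanSpace ℝ (Fin 3) => mollify η (ε k) (U k) z.1 z.2 - mollify η (ε k) Ul z.1 z.2) 3 (volume.restrict Q)
        = eLpNorm (fun z : ℝ × EuclideanSpace ℝ (Fin 3) => mollify η (ε k) (fun s y => U k s y - Ul s y) z.1 z.2) 3 (volume.restrict Q) :=
          eLpNorm_congr_ae (ae_restrict_of_ae hlin)
      _ ≤ L * eLpNorm (uncurry fun s y => U k s y - Ul s y) 3 (volume.restrict Qp) :=
          eLpNorm_cylinder_mollify_le hη hρ (hε k) hk (U := fun s y => U k s y - Ul s y)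
            (by have := (hUm k).sub hUlm; exact this) (Ioo a b) R
      _ = L * eLpNorm (fun z : ℝ × EuclideanSpace ℝ (Fin 3) => U k z.1 z.2 - Ul z.1 z.2) 3 (volume.restrict Qp) := rfl
  -- the bound tends to zero
  have hlim : Tendsto (fun k => L * eLpNorm (fun z : ℝ × EuclideanSpace ℝ (Fin 3) => U k z.1 z.2 - Ul z.1 z.2) 3 (volume.restrict Qp) +
      eLpNorm (fun z : ℝ × EuclideanSpace ℝ (Fin 3) => mollify η (ε k) Ul z.1 z.2 - Ul z.1 z.2) 3 (volume.restrict Q)) atTop (𝓝 0) := by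
    have h1 := ENNReal.Tendsto.const_mul hconv (a := L) (Or.inr hLtop)
    rw [mul_zero] at h1
    simpa using h1.add hself
  exact tendsto_of_tendsto_of_tendsto_of_le_of_le' tendsto_const_nhds hlim (Eventually.of_forall fun _ => zero_le) hbound

end ApproximateIdentity

end BradshawTsai2017

end Literature.Analysis.FluidPDE

end
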